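import Mathlib
import Literature.NumberTheory.Transcendental.KZCalculusProofs
import Literature.NumberTheory.Transcendental.KZLogCalculusProofs
import Literature.NumberTheory.Transcendental.KZSubcalculusInvariants
import Literature.NumberTheory.Transcendental.BoxCoordinatePowerMap
import Literature.NumberTheory.Transcendental.BoxIntegralZetaValues

/-!
# Line `odd-hyperbolic-ladder`: the odd/even splitting of `ζ(2k)` (stub `stub_zetaBoxOddEvenAll`)

Stub `stub_zetaBoxOddEvenAll` of the crux `OffTetraSectorKernel` (item
stmt-KontsevichZagierPeriods-10557, route HyperbolicBloch): the all-dimension version of the landed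
`stub_zetaBoxOddEven` (`k = 1`).
On the open unit box `□ = (0,1)^{2k}` put `P = ∏ᵢ xᵢ`. The two Kontsevich–Zagier representations
`Z = [□, 1/(1 − P)]` (value `ζ(2k)`) and `Z' = [□, 1/(1 − ∏ᵢ xᵢ²)]` (value `(1 − 4^{-k}) ζ(2k)`,
the odd part of `Σ 1/n^{2k}`) satisfy `(4^k − 1)·[Z] ≡ 4^k·[Z']` modulo the moves of the calculus.
This is Kontsevich–Zagier's own un-derived step "`Σ 1/n^{2k} = Σ_odd + 4^{-k} Σ 1/n^{2k}`" of
§1.2, realised by three explicit moves: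

* rule (1b), integrand additivity: pointwise on `□`, `1/(1 − P) = 1/(1 − P²) + P/(1 − P²)` and
  `P² = ∏ᵢ xᵢ²`, so `[Z] − [Z'] − [M] ∈ integrandAddRel` with `M = [□, P/(1 − ∏ᵢ xᵢ²)]` (which
  exists: rational integrand, dominated by `1/(1 − P)`);
* rule (2), change of variables: the coordinatewise squaring map `Φ(x) = (xᵢ²)ᵢ` is a bijection of
  `□` with Jacobian `2^{2k} ∏ᵢ xᵢ = 4^k P` (`BoxIntegral.coordPow 2`), and
  `4^k P/(1 − ∏ᵢ xᵢ²) = [1/(1 − ∏ᵢ uᵢ)]∘Φ · |det Φ'|`, so `[□, 4^k·P/(1 − ∏ᵢ xᵢ²)] − [Z] ∈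
  changeOfVariablesRel`;
* rule (1b) again, integer scaling: `[□, 4^k f] − 4^k·[□, f] ∈ relations`
  (`KZ.IntegralRep.of_constMul_nat_sub_nsmul_mem_relations`);

and the bookkeeping `(N − 1)[Z] − N[Z'] = N([Z] − [Z'] − [M]) − ([N M] − N[M]) + ([N M] − [Z])`,
`N = 4^k`.

References: M. Kontsevich, D. Zagier, *Periods* (2001), §1.2 (p. 9); J. Bochnak, M. Coste,
M.-F. Roy, *Real Algebraic Geometry* (1998), §2.2.
-/

noncomputable section

open Set MeasureTheory MvPolynomial
open Literature.NumberTheory.Transcendental Literature.ModelTheory.ExponentialFields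

namespace Summit.KontsevichZagierPeriods.HyperbolicBloch.OffTetraSectorKernel

/-! ### Pointwise facts on the open unit box `(0,1)ⁿ`, `n ≥ 1` -/

/-- On the open unit box `(0,1)ⁿ` (`n ≥ 1`) the two denominators `1 − ∏ᵢ xᵢ` and `1 − ∏ᵢ xᵢ²` are
positive (`0 < ∏ᵢ xᵢ < 1`, `BoxIntegral.prod_mem_Ioo`). [folklore] -/
theorem zetaBoxAll_denom_pos {n : ℕ} (hn : n ≠ 0) {x : Fin n → ℝ} (hx : ∀ i, x i ∈ Ioo (0 : ℝ) 1) :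
    0 < 1 - ∏ i, x i ∧ 0 < 1 - ∏ i, x i ^ 2 := by
  obtain ⟨h0, h1⟩ := BoxIntegral.prod_mem_Ioo hn hx
  refine ⟨by linarith, ?_⟩
  rw [Finset.prod_pow]
  nlinarith

/-- **The odd/even splitting, pointwise**: `1/(1 − P) = 1/(1 − P²) + P/(1 − P²)` for `P = ∏ᵢ xᵢ` on
the open unit box, with `P² = ∏ᵢ xᵢ²` (`1 − P² = (1 − P)(1 + P)`).
[cite: KontsevichZagier2001, §1.2] -/
theorem zetaBoxAll_split {n : ℕ} (hn : n ≠ 0) {x : Fin n → ℝ} (hx : ∀ i, x i ∈ Ioo (0 : ℝ) 1) :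
    1 / (1 - ∏ i, x i) = 1 / (1 - ∏ i, x i ^ 2) + (∏ i, x i) / (1 - ∏ i, x i ^ 2) := by
  obtain ⟨h0, h1⟩ := zetaBoxAll_denom_pos hn hx
  have h0' : 1 - ∏ i, x i ≠ 0 := h0.ne'
  have h1' : 1 - ∏ i, x i ^ 2 ≠ 0 := h1.ne'
  rw [Finset.prod_pow] at h1' ⊢
  field_simp
  ring

/-- The mixed term is dominated by the full kernel on the box:
`0 ≤ P/(1 − ∏ᵢ xᵢ²) ≤ 1/(1 − P)`, `P = ∏ᵢ xᵢ`. [folklore] -/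
theorem zetaBoxAll_mixed_le {n : ℕ} (hn : n ≠ 0) {x : Fin n → ℝ} (hx : ∀ i, x i ∈ Ioo (0 : ℝ) 1) :
    0 ≤ (∏ i, x i) / (1 - ∏ i, x i ^ 2) ∧
      (∏ i, x i) / (1 - ∏ i, x i ^ 2) ≤ 1 / (1 - ∏ i, x i) := by
  obtain ⟨h0, h1⟩ := zetaBoxAll_denom_pos hn hx
  obtain ⟨hm0, -⟩ := BoxIntegral.prod_mem_Ioo hn hx
  refine ⟨div_nonneg hm0.le h1.le, ?_⟩
  rw [zetaBoxAll_split hn hx]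
  have : 0 ≤ 1 / (1 - ∏ i, x i ^ 2) := div_nonneg zero_le_one h1.le
  linarith

/-! ### The mixed representation `M = [□, P/(1 − ∏ᵢ xᵢ²)]` -/

/-- **The mixed representation exists** in every dimension `n ≥ 1`. On the open unit box the
function `(∏ᵢ xᵢ)/(1 − ∏ᵢ xᵢ²)` is a quotient of rational polynomials with non-vanishing denominator
(hence `ℚ`-semialgebraic) and is integrable, being measurable and dominated by the integrable
kernel `1/(1 − ∏ᵢ xᵢ)` of `Z`. [cite: KontsevichZagier2001, §1.1] -/
theorem zetaBoxAll_exists_mixed {n : ℕ} (hn : n ≠ 0) (Z : KZ.IntegralRep n)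
    (hZ : Z.domain = {x | ∀ i, x i ∈ Ioo (0 : ℝ) 1})
    (hZi : EqOn Z.integrand (fun x => 1 / (1 - ∏ i, x i)) Z.domain) :
    ∃ M : KZ.IntegralRep n, M.domain = {x | ∀ i, x i ∈ Ioo (0 : ℝ) 1} ∧
      M.integrand = fun x => (∏ i, x i) / (1 - ∏ i, x i ^ 2) := by
  have hσ : IsSemialgebraic ℚ {x : Fin n → ℝ | ∀ i, x i ∈ Ioo (0 : ℝ) 1} :=
    hZ ▸ Z.isSemialgebraic_domain
  have hmeas : MeasurableSet {x : Fin n → ℝ | ∀ i, x i ∈ Ioo (0 : ℝ) 1} :=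
    BoxIntegral.measurableSet_box n
  -- semialgebraicity: a quotient of rational polynomials
  have hq : ∀ x ∈ {x : Fin n → ℝ | ∀ i, x i ∈ Ioo (0 : ℝ) 1},
      aeval x (1 - ∏ i, X i ^ 2 : MvPolynomial (Fin n) ℚ) ≠ 0 := fun x hx => by
    simpa [map_prod] using (zetaBoxAll_denom_pos hn hx).2.ne'
  have hsa : IsSemialgebraicFunOn ℚ {x : Fin n → ℝ | ∀ i, x i ∈ Ioo (0 : ℝ) 1}
      (fun x => (∏ i, x i) / (1 - ∏ i, x i ^ 2)) :=
    (isSemialgebraicFunOn_aeval_div_aeval hσ (∏ i, X i) (1 - ∏ i, X i ^ 2) hq).congr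
      fun x _ => by simp [map_prod]
  -- integrability: dominated by the kernel of `Z`
  have hint : IntegrableOn (fun x : Fin n → ℝ => (∏ i, x i) / (1 - ∏ i, x i ^ 2))
      {x : Fin n → ℝ | ∀ i, x i ∈ Ioo (0 : ℝ) 1} := by
    have hZint : IntegrableOn Z.integrand {x : Fin n → ℝ | ∀ i, x i ∈ Ioo (0 : ℝ) 1} :=
      hZ ▸ Z.integrableOn
    refine Integrable.mono' hZint (KZ.aestronglyMeasurable_of_isSemialgebraicFunOn hsa hmeas)
      ((ae_restrict_mem hmeas).mono fun x hx => ?_)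
    obtain ⟨h0, h1⟩ := zetaBoxAll_mixed_le hn hx
    rw [Real.norm_eq_abs, abs_of_nonneg h0, hZi (by rw [hZ]; exact hx)]
    exact h1
  exact ⟨⟨_, _, hσ, hsa, hint⟩, rfl, rfl⟩

/-! ### The stub -/

/-- **STUB `stub_zetaBoxOddEvenAll`: the odd/even splitting of `Σ 1/n^{2k}` inside the calculus,
every `k ≥ 1`**, `(4^k − 1)·[(0,1)^{2k}, 1/(1−∏xᵢ)] ≡ 4^k·[(0,1)^{2k}, 1/(1−∏xᵢ²)]`: integrand
additivity `1/(1−P) = 1/(1−P²) + P/(1−P²)` (`P = ∏xᵢ`, rule (1b)), the coordinatewise squaring map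
`x ↦ (xᵢ²)ᵢ` of the open box onto itself (Jacobian `2^{2k}∏xᵢ = 4^k P`; rule (2)), which turns
`[□, 4^k·P/(1−∏xᵢ²)]` into `[□, 1/(1−∏uᵢ)]`, and integer bookkeeping by additivity
(`[σ, 4^k f] ≡ 4^k·[σ, f]`). [cite: KontsevichZagier2001, §1.2] -/
theorem stub_zetaBoxOddEvenAll :
    ∀ (k : ℕ), 1 ≤ k → ∀ (Z Z' : KZ.IntegralRep (2 * k)),
      Z.domain = {x | ∀ i, x i ∈ Set.Ioo (0:ℝ) 1} →
      Set.EqOn Z.integrand (fun x => 1 / (1 - ∏ i, x i)) Z.domain →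
      Z'.domain = {x | ∀ i, x i ∈ Set.Ioo (0:ℝ) 1} →
      Set.EqOn Z'.integrand (fun x => 1 / (1 - ∏ i, x i ^ 2)) Z'.domain →
      (4 ^ k - 1) • KZ.of Z - 4 ^ k • KZ.of Z' ∈ KZ.relations := by
  intro k hk Z Z' hZ hZi hZ' hZ'i
  have hn : 2 * k ≠ 0 := by omega
  obtain ⟨M, hMd, hMi⟩ := zetaBoxAll_exists_mixed hn Z hZ hZi
  have hσ : IsSemialgebraic ℚ {x : Fin (2 * k) → ℝ | ∀ i, x i ∈ Ioo (0 : ℝ) 1} :=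
    hZ ▸ Z.isSemialgebraic_domain
  -- rule (1b): `[Z] − [Z'] − [M]`
  have h1b : KZ.of Z - KZ.of Z' - KZ.of M ∈ KZ.relations := by
    refine KZ.integrandAddRel_subset_relations ⟨2 * k, Z, Z', M, by rw [hZ, hZ'], by rw [hMd, hZ],
      fun x hx => ?_, rfl⟩
    have hxB : ∀ i, x i ∈ Ioo (0 : ℝ) 1 := by rw [hZ] at hx; exact hx
    rw [Pi.add_apply, hZi hx, hZ'i (by rw [hZ']; exact hxB), hMi]
    exact zetaBoxAll_split hn hxB
  -- the scaled mixed representation `[□, 4^k·P/(1 − ∏ xᵢ²)]`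
  set M4 : KZ.IntegralRep (2 * k) := M.constMul ((4 ^ k : ℕ) : ℝ) (isAlgebraic_nat (4 ^ k))
    with hM4
  have hM4d : M4.domain = {x | ∀ i, x i ∈ Ioo (0 : ℝ) 1} := by
    rw [hM4, KZ.IntegralRep.domain_constMul, hMd]
  -- rule (1b), integer scaling: `[4^k M] − 4^k [M]`
  have hscale : KZ.of M4 - (4 ^ k) • KZ.of M ∈ KZ.relations :=
    KZ.IntegralRep.of_constMul_nat_sub_nsmul_mem_relations M (4 ^ k)
  -- rule (2): the squaring map carries `[4^k M]` to `[Z]`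
  have hcov : KZ.of M4 - KZ.of Z ∈ KZ.relations := by
    refine KZ.changeOfVariablesRel_subset_relations
      ⟨2 * k, M4, Z, BoxIntegral.coordPow 2, BoxIntegral.coordPowDeriv 2, ?_,
        fun x _ => BoxIntegral.hasFDerivWithinAt_coordPow 2 _ x, ?_, ?_, ?_, rfl⟩
    · -- the squaring map is polynomial, hence `ℚ`-semialgebraic
      rw [hM4d]
      refine (isSemialgebraicMapOn_aeval hσ
        (fun j => (X j : MvPolynomial (Fin (2 * k)) ℚ) ^ 2)).congr fun x _ => ?_
      funext j
      simp [BoxIntegral.coordPow]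
    · rw [hM4d]
      exact BoxIntegral.injOn_coordPow_box two_ne_zero
    · rw [hM4d, hZ]
      exact (BoxIntegral.image_coordPow_box two_ne_zero).symm
    · intro x hx
      rw [hM4d] at hx
      have hΦx : BoxIntegral.coordPow 2 x ∈ Z.domain := by
        rw [hZ]
        exact BoxIntegral.mapsTo_coordPow_box two_ne_zero hx
      have h4 : ((4 ^ k : ℕ) : ℝ) = (2 : ℝ) ^ (2 * k) := by
        rw [Nat.cast_pow, pow_mul]
        norm_num
      rw [BoxIntegral.abs_det_coordPowDeriv two_ne_zero hx, hZi hΦx, hM4,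
        KZ.IntegralRep.integrand_constMul, hMi, h4]
      simp only [BoxIntegral.coordPow_apply, Nat.cast_ofNat, Nat.add_one_sub_one, pow_one]
      ring
  -- bookkeeping: `4^k = N + 1`
  obtain ⟨N, hN⟩ : ∃ N : ℕ, 4 ^ k = N + 1 :=
    ⟨4 ^ k - 1, (Nat.sub_add_cancel (Nat.one_le_pow k 4 (by norm_num))).symm⟩
  rw [hN] at hscale ⊢
  have hsum : (N + 1 - 1) • KZ.of Z - (N + 1) • KZ.of Z' =
      (N + 1) • (KZ.of Z - KZ.of Z' - KZ.of M) - (KZ.of M4 - (N + 1) • KZ.of M)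
        + (KZ.of M4 - KZ.of Z) := by
    simp only [Nat.add_sub_cancel, add_nsmul, one_nsmul, nsmul_sub]
    abel
  rw [hsum]
  exact KZ.relations.add_mem (KZ.relations.sub_mem (KZ.relations.nsmul_mem h1b _) hscale) hcov

end Summit.KontsevichZagierPeriods.HyperbolicBloch.OffTetraSectorKernel

end
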